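import Literature.Probability.LatticeModels.ThermodynamicLimit
import Literature.MathematicalPhysics.QuantumFieldTheory.QCD
import Mathlib

/-!
# Existence of the periodic cell–wall tiling with thick collars (sub-goal ASM2 of the modular template)

Sub-goal ASM2 of crux stmt-QuantumFields-8967 (`Summit.QuantumFields.QCD.Theses.SpectralDefectExtinction.TipPricing`,
line `hermitian-flow-coarea`, lead c2; the `∃`-package is consumed by the final assembly `stub_spreadOfCells`).
Pure arithmetic/combinatorics, no spectral theory.

**What is proved (`tiling_exists`).**  Given a cell radius `ℓ`, a minimal collar width `W₀`, a target `g > 0` and a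
wall constant `g₁ > 0`, there are a collar width `W ≥ max W₀ 2`, a big-box radius `R`, a number `N` of cells and
centres `z k ∈ 3ℤ⁴` (`k : Fin N`) such that the cells-with-collars `z k + {−(ℓ+W)..ℓ+W}⁴` lie in the big box
`{−R..R}⁴` (`box 4 R` of `Literature.Probability.LatticeModels`), are pairwise disjoint and cover it, with
`N ≥ 96(2R+1)³ + 1` and the explicit Schur-locality error
`12(2R+1)⁴ · (96 · (2/g₁) · (12(2R+1)⁴ · 96) · ((2/g₁) · exp(−(g₁/400)(W−1))) · 96) < g`.

**Construction.**  With `L = ℓ + W` and period `P = 2L+1`, take `m = 2q+1` copies per axis (`q = 48 P³`),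
`R = qP + L` (so `2R+1 = mP`), `N = m⁴`, and `z k i = P · (κ i − q)` where `κ = finFunctionFinEquiv.symm k :
Fin 4 → Fin m` is the base-`m` multi-index of `k`.  Containment, disjointness and covering are checked one
coordinate at a time (`{−R..R} = ⊔_{j<m} (P(j−q) + {−L..L})`, Euclidean division by `P`); `3 ∣ z k i` because
`W` is chosen with `3 ∣ P`; `N = m·m³ ≥ (96P³+1)m³ ≥ 96(mP)³ + 1`.  Finally `2R+1 = 96P⁴ + P ≤ 97P⁴` and
`P ≤ (2ℓ+5)(W−1)`, so the error is `≤ C(ℓ,g₁) · t³² e^{−at}` with `t = W − 1`, `a = g₁/400`, and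
`t³² e^{−at} ≤ 33!/(a³³ t)` (from `xⁿ/n! ≤ eˣ`, Mathlib's `Real.pow_div_factorial_le_exp`) is below `g` for
`t` large.  Everything leaned on is in Mathlib (`finFunctionFinEquiv`, `Int.mul_ediv_add_emod`,
`Int.ediv_lt_of_lt_mul`, `Real.pow_div_factorial_le_exp`, `exists_nat_gt`) or is the tree's `box`/`mem_box`.
No named facts.
-/

noncomputable section

namespace Summit.QuantumFields.QCD.Cruxes.TipPricing.ModularTemplate

open Literature.Probability.LatticeModels
open scoped BigOperators

/-! ### One-dimensional tiling of `{−(qP+L)..qP+L}` by the `2q+1` translates `P(j−q) + {−L..L}`, `P = 2L+1` -/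

/-- Containment: for a digit `0 ≤ j ≤ 2q` and `|y| ≤ L`, the point `(2L+1)(j−q) + y` lies in `{−(q(2L+1)+L)..q(2L+1)+L}`. -/
private theorem tiling_coord_mem {L q j y : ℤ} (hL : 0 ≤ L) (hj0 : 0 ≤ j) (hj : j ≤ 2 * q) (hy1 : -L ≤ y)
    (hy2 : y ≤ L) :
    -(q * (2 * L + 1) + L) ≤ (2 * L + 1) * (j - q) + y ∧ (2 * L + 1) * (j - q) + y ≤ q * (2 * L + 1) + L := by
  have h1 : 0 ≤ (2 * L + 1) * j := mul_nonneg (by linarith) hj0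
  have h2 : (2 * L + 1) * j ≤ (2 * L + 1) * (2 * q) := mul_le_mul_of_nonneg_left hj (by linarith)
  constructor <;> linarith

/-- Disjointness: translates with different digits `j ≠ j'` never meet, since `|y − y'| ≤ 2L < 2L+1`. -/
private theorem tiling_coord_ne {L q j j' y y' : ℤ} (hL : 0 ≤ L) (hjj : j ≠ j') (hy1 : -L ≤ y) (hy2 : y ≤ L)
    (hy1' : -L ≤ y') (hy2' : y' ≤ L) : (2 * L + 1) * (j - q) + y ≠ (2 * L + 1) * (j' - q) + y' := by
  intro heq
  rcases lt_or_gt_of_ne hjj with hlt | hlt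
  · have : (2 * L + 1) * 1 ≤ (2 * L + 1) * (j' - j) := mul_le_mul_of_nonneg_left (by omega) (by omega)
    linarith
  · have : (2 * L + 1) * 1 ≤ (2 * L + 1) * (j - j') := mul_le_mul_of_nonneg_left (by omega) (by omega)
    linarith

/-- Covering: every `x` with `|x| ≤ q(2L+1)+L` is `(2L+1)(j−q) + y` for a digit `0 ≤ j < 2q+1` and `|y| ≤ L`
(Euclidean division of `x + q(2L+1) + L ∈ {0..(2q+1)(2L+1)−1}` by `2L+1`). -/
private theorem tiling_coord_cover {L q x : ℤ} (hL : 0 ≤ L) (hx1 : -(q * (2 * L + 1) + L) ≤ x)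
    (hx2 : x ≤ q * (2 * L + 1) + L) :
    ∃ j y : ℤ, 0 ≤ j ∧ j < 2 * q + 1 ∧ -L ≤ y ∧ y ≤ L ∧ x = (2 * L + 1) * (j - q) + y := by
  have hP0 : (0 : ℤ) < 2 * L + 1 := by omega
  obtain ⟨s, hs⟩ : ∃ s : ℤ, s = x + (q * (2 * L + 1) + L) := ⟨_, rfl⟩
  have hs0 : 0 ≤ s := by rw [hs]; linarith
  have hs1 : s < (2 * q + 1) * (2 * L + 1) := by rw [hs]; linarith
  have hdm := Int.mul_ediv_add_emod s (2 * L + 1)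
  have hm0 := Int.emod_nonneg s hP0.ne'
  have hm1 := Int.emod_lt_of_pos s hP0
  refine ⟨s / (2 * L + 1), s % (2 * L + 1) - L, Int.ediv_nonneg hs0 hP0.le, Int.ediv_lt_of_lt_mul hP0 hs1,
    by linarith, by linarith, ?_⟩
  linear_combination -hs - hdm

/-! ### The four-dimensional tiling -/

/-- The periodic tiling of `{−(q(2L+1)+L)..q(2L+1)+L}⁴` by the `(2q+1)⁴` translates `z k + {−L..L}⁴`,
`z k i = (2L+1)(κ i − q)` with `κ = finFunctionFinEquiv.symm k` the base-`(2q+1)` digits of `k`: containment,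
disjointness, covering, and `3 ∣ z k i` when `3 ∣ 2L+1`. -/
private theorem tiling_core (L q : ℕ) (h3 : (3 : ℤ) ∣ 2 * (L : ℤ) + 1) :
    ∃ z : Fin ((2 * q + 1) ^ 4) → (Fin 4 → ℤ),
      (∀ k, ∀ (y : Fin 4 → ℤ), y ∈ box 4 L → z k + y ∈ box 4 (q * (2 * L + 1) + L)) ∧
      (∀ k k', k ≠ k' → ∀ (y y' : Fin 4 → ℤ), y ∈ box 4 L → y' ∈ box 4 L → z k + y ≠ z k' + y') ∧
      (∀ (x : Fin 4 → ℤ), x ∈ box 4 (q * (2 * L + 1) + L) →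
        ∃ (k : Fin ((2 * q + 1) ^ 4)) (y : Fin 4 → ℤ), y ∈ box 4 L ∧ x = z k + y) ∧
      (∀ k (i : Fin 4), (3 : ℤ) ∣ z k i) := by
  refine ⟨fun k i => (2 * (L : ℤ) + 1) * (((finFunctionFinEquiv.symm k i : ℕ) : ℤ) - q), ?_, ?_, ?_, ?_⟩
  · intro k y hy
    rw [mem_box] at hy ⊢
    intro i
    have hj := (finFunctionFinEquiv.symm k i).isLt
    have := tiling_coord_mem (L := L) (q := q) (j := ((finFunctionFinEquiv.symm k i : ℕ) : ℤ)) (y := y i)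
      (by positivity) (by positivity) (by omega) (hy i).1 (hy i).2
    simp only [Pi.add_apply]
    push_cast
    exact this
  · intro k k' hkk y y' hy hy' heq
    have hne : finFunctionFinEquiv.symm k ≠ finFunctionFinEquiv.symm k' :=
      fun h' => hkk (finFunctionFinEquiv.symm.injective h')
    obtain ⟨i, hi⟩ := Function.ne_iff.1 hne
    have hi' : ((finFunctionFinEquiv.symm k i : ℕ) : ℤ) ≠ ((finFunctionFinEquiv.symm k' i : ℕ) : ℤ) :=
      fun h'' => hi (Fin.ext (by exact_mod_cast h''))
    rw [mem_box] at hy hy'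
    have := congrFun heq i
    simp only [Pi.add_apply] at this
    exact tiling_coord_ne (L := L) (q := q) (by positivity) hi' (hy i).1 (hy i).2 (hy' i).1 (hy' i).2 this
  · intro x hx
    rw [mem_box] at hx
    have hc : ∀ i : Fin 4, ∃ j y : ℤ, 0 ≤ j ∧ j < 2 * q + 1 ∧ -(L : ℤ) ≤ y ∧ y ≤ L ∧
        x i = (2 * L + 1) * (j - q) + y := by
      intro i
      have hxi := hx i
      push_cast at hxi
      exact tiling_coord_cover (by positivity) hxi.1 hxi.2
    choose j y hj0 hj1 hy1 hy2 hxe using hc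
    refine ⟨finFunctionFinEquiv (fun i => ⟨(j i).toNat, ?_⟩), y, ?_, ?_⟩
    · have := hj1 i
      have := hj0 i
      omega
    · rw [mem_box]
      exact fun i => ⟨hy1 i, hy2 i⟩
    · funext i
      simp only [Pi.add_apply, Equiv.symm_apply_apply]
      rw [Int.toNat_of_nonneg (hj0 i)]
      exact hxe i
  · intro k i
    exact Dvd.dvd.mul_right h3 _

/-- Counting: `m ≥ 96P³ + 1` forces `96(mP)³ + 1 ≤ m⁴`. -/
private theorem tiling_count (m P : ℕ) (hm : 96 * P ^ 3 + 1 ≤ m) : 96 * (m * P) ^ 3 + 1 ≤ m ^ 4 := by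
  have h1 : 1 ≤ m ^ 3 := Nat.one_le_pow _ _ (by omega)
  calc 96 * (m * P) ^ 3 + 1 = 96 * P ^ 3 * m ^ 3 + 1 := by ring
    _ ≤ 96 * P ^ 3 * m ^ 3 + m ^ 3 := by linarith
    _ = (96 * P ^ 3 + 1) * m ^ 3 := by ring
    _ ≤ m * m ^ 3 := Nat.mul_le_mul_right _ hm
    _ = m ^ 4 := by ring

/-! ### The error bound -/

/-- The Schur-locality error is below any `g > 0` once the collar width `W` is large, uniformly over big boxes with
`2R+1 = X ≤ 97(2(ℓ+W)+1)⁴`: the error is `12²·96³·(2/g₁)² · X⁸ · e^{−a(W−1)}` (`a = g₁/400`), `X⁸ ≤ 97⁸(2ℓ+5)³² t³²`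
with `t = W−1 ≥ 1`, and `t³² e^{−at} ≤ 33!/(a³³ t)`. -/
private theorem tiling_err_small (ℓ : ℕ) {g g₁ : ℝ} (hg : 0 < g) (hg₁ : 0 < g₁) :
    ∃ W₁ : ℕ, ∀ (W : ℕ) (X : ℝ), W₁ ≤ W → 2 ≤ W → 0 ≤ X → X ≤ 97 * (2 * ((ℓ : ℝ) + W) + 1) ^ 4 →
      12 * X ^ 4 * (96 * (2 / g₁) * (12 * X ^ 4 * 96) * (2 / g₁ * Real.exp (-(g₁ / 400 * ((W : ℝ) - 1)))) * 96)
        < g := by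
  have ha : (0 : ℝ) < g₁ / 400 := by positivity
  obtain ⟨M, hM0, hM⟩ : ∃ M : ℝ, 0 < M ∧ M = (12 ^ 2 * 96 ^ 3 * (2 / g₁) ^ 2) *
      ((97 : ℝ) ^ 8 * (2 * ℓ + 5) ^ 32) * ((Nat.factorial 33 : ℝ) / (g₁ / 400) ^ 33) :=
    ⟨_, by positivity, rfl⟩
  obtain ⟨W₁, hW₁⟩ := exists_nat_gt (M / g + 1)
  refine ⟨W₁, fun W X hW hW2 hX0 hX => ?_⟩
  obtain ⟨t, ht⟩ : ∃ t : ℝ, t = (W : ℝ) - 1 := ⟨_, rfl⟩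
  have hW2' : (2 : ℝ) ≤ W := by exact_mod_cast hW2
  have hWW : (W₁ : ℝ) ≤ W := by exact_mod_cast hW
  have ht1 : 1 ≤ t := by linarith
  have ht0 : 0 < t := by linarith
  have htM : M / g < t := by linarith
  have hℓ : (0 : ℝ) ≤ ℓ := Nat.cast_nonneg ℓ
  -- the period `2(ℓ+W)+1` is at most `(2ℓ+5) t`
  have hp : 2 * ((ℓ : ℝ) + W) + 1 ≤ (2 * ℓ + 5) * t := by
    rw [ht]
    nlinarith [mul_nonneg (by linarith : (0 : ℝ) ≤ 2 * ℓ + 3) (by linarith : (0 : ℝ) ≤ (W : ℝ) - 2)]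
  -- `X⁸ ≤ 97⁸ (2ℓ+5)³² t³²`
  have hX1 : X ≤ 97 * ((2 * ℓ + 5) * t) ^ 4 :=
    hX.trans (mul_le_mul_of_nonneg_left (pow_le_pow_left₀ (by positivity) hp 4) (by norm_num))
  have hX8 : X ^ 8 ≤ (97 : ℝ) ^ 8 * (2 * ℓ + 5) ^ 32 * t ^ 32 := by
    calc X ^ 8 ≤ (97 * ((2 * ℓ + 5) * t) ^ 4) ^ 8 := pow_le_pow_left₀ hX0 hX1 8
      _ = (97 : ℝ) ^ 8 * (2 * ℓ + 5) ^ 32 * t ^ 32 := by ring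
  -- polynomial times exponential decay: `t³² e^{−at} ≤ 33!/(a³³ t)`
  have hE : t ^ 32 * Real.exp (-(g₁ / 400 * t)) ≤ (Nat.factorial 33 : ℝ) / (g₁ / 400) ^ 33 / t := by
    rw [le_div_iff₀ ht0, le_div_iff₀ (pow_pos ha 33)]
    have h1 := Real.pow_div_factorial_le_exp (x := g₁ / 400 * t) (by positivity) 33
    rw [div_le_iff₀ (by positivity)] at h1
    calc t ^ 32 * Real.exp (-(g₁ / 400 * t)) * t * (g₁ / 400) ^ 33
        = (g₁ / 400 * t) ^ 33 * Real.exp (-(g₁ / 400 * t)) := by ring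
      _ ≤ Real.exp (g₁ / 400 * t) * (Nat.factorial 33) * Real.exp (-(g₁ / 400 * t)) :=
          mul_le_mul_of_nonneg_right h1 (Real.exp_pos _).le
      _ = Nat.factorial 33 * (Real.exp (g₁ / 400 * t) * Real.exp (-(g₁ / 400 * t))) := by ring
      _ = Nat.factorial 33 := by rw [← Real.exp_add, add_neg_cancel, Real.exp_zero, mul_one]
  -- assemble
  calc 12 * X ^ 4 * (96 * (2 / g₁) * (12 * X ^ 4 * 96) * (2 / g₁ * Real.exp (-(g₁ / 400 * ((W : ℝ) - 1)))) * 96)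
      = (12 ^ 2 * 96 ^ 3 * (2 / g₁) ^ 2) * (X ^ 8 * Real.exp (-(g₁ / 400 * t))) := by rw [ht]; ring
    _ ≤ (12 ^ 2 * 96 ^ 3 * (2 / g₁) ^ 2) * (((97 : ℝ) ^ 8 * (2 * ℓ + 5) ^ 32 * t ^ 32) *
          Real.exp (-(g₁ / 400 * t))) :=
        mul_le_mul_of_nonneg_left (mul_le_mul_of_nonneg_right hX8 (Real.exp_pos _).le) (by positivity)
    _ = (12 ^ 2 * 96 ^ 3 * (2 / g₁) ^ 2) * ((97 : ℝ) ^ 8 * (2 * ℓ + 5) ^ 32) *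
          (t ^ 32 * Real.exp (-(g₁ / 400 * t))) := by ring
    _ ≤ (12 ^ 2 * 96 ^ 3 * (2 / g₁) ^ 2) * ((97 : ℝ) ^ 8 * (2 * ℓ + 5) ^ 32) *
          ((Nat.factorial 33 : ℝ) / (g₁ / 400) ^ 33 / t) := mul_le_mul_of_nonneg_left hE (by positivity)
    _ = M / t := by rw [hM]; ring
    _ < g := by
        rw [div_lt_iff₀ ht0]
        have := (div_lt_iff₀ hg).1 htM
        linarith

/-! ### The stub -/

/-- **ASM2. Tiling arithmetic.**  For every cell radius `ℓ`, minimal collar width `W₀`, gap `g > 0` and wall constant `g₁ > 0`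
there are a collar width `W ≥ max W₀ 2`, a big-box radius `R`, a number `N ≥ 96(2R+1)³ + 1` of cells and centres `z k ∈ 3ℤ⁴` whose
cells-with-collars `z k + {−(ℓ+W)..ℓ+W}⁴` tile `{−R..R}⁴` exactly, with the Schur-locality error at `(R, W, g₁)` below `g`. -/
theorem tiling_exists (ℓ W₀ : ℕ) (g g₁ : ℝ) (hg : 0 < g) (hg₁ : 0 < g₁) :
    ∃ (W R N : ℕ) (z : Fin N → (Fin 4 → ℤ)), W₀ ≤ W ∧ 2 ≤ W ∧
      (∀ k, ∀ (y : Fin 4 → ℤ), y ∈ box 4 (ℓ + W) → z k + y ∈ box 4 R) ∧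
      (∀ k k', k ≠ k' → ∀ (y y' : Fin 4 → ℤ), y ∈ box 4 (ℓ + W) → y' ∈ box 4 (ℓ + W) → z k + y ≠ z k' + y') ∧
      (∀ (x : Fin 4 → ℤ), x ∈ box 4 R → ∃ (k : Fin N) (y : Fin 4 → ℤ), y ∈ box 4 (ℓ + W) ∧ x = z k + y) ∧
      (∀ (k : Fin N) (i : Fin 4), (3 : ℤ) ∣ z k i) ∧
      96 * (2 * R + 1) ^ 3 + 1 ≤ N ∧
      12 * (2 * (R : ℝ) + 1) ^ 4 * (96 * (2 / g₁) * (12 * (2 * (R : ℝ) + 1) ^ 4 * 96) *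
          (2 / g₁ * Real.exp (-(g₁ / 400 * ((W : ℝ) - 1)))) * 96) < g := by
  obtain ⟨W₁, hW₁⟩ := tiling_err_small ℓ hg hg₁
  -- collar width: above `W₀`, `2` and `W₁`, in the residue class making the period `2(ℓ+W)+1` a multiple of `3`
  obtain ⟨W, hW⟩ : ∃ W : ℕ, W = 3 * (W₀ + W₁ + 2) + 2 * ℓ + 1 := ⟨_, rfl⟩
  -- `2q+1 = 96 P³ + 1` translates per axis, `P = 2(ℓ+W)+1`
  obtain ⟨q, hq⟩ : ∃ q : ℕ, q = 48 * (2 * (ℓ + W) + 1) ^ 3 := ⟨_, rfl⟩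
  have h3 : (3 : ℤ) ∣ 2 * ((ℓ + W : ℕ) : ℤ) + 1 := ⟨2 * ((W₀ : ℤ) + W₁ + 2 + ℓ) + 1, by rw [hW]; push_cast; ring⟩
  obtain ⟨z, hin, hdisj, hcover, hdiv⟩ := tiling_core (ℓ + W) q h3
  refine ⟨W, q * (2 * (ℓ + W) + 1) + (ℓ + W), (2 * q + 1) ^ 4, z, by omega, by omega, hin, hdisj, hcover, hdiv,
    ?_, ?_⟩
  · have e1 : 2 * (q * (2 * (ℓ + W) + 1) + (ℓ + W)) + 1 = (2 * q + 1) * (2 * (ℓ + W) + 1) := by ring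
    rw [e1]
    exact tiling_count (2 * q + 1) (2 * (ℓ + W) + 1) (le_of_eq (by rw [hq]; ring))
  · have hWW : W₁ ≤ W := by omega
    have hW2 : 2 ≤ W := by omega
    refine hW₁ W _ hWW hW2 (by positivity) ?_
    have hℓ : (0 : ℝ) ≤ ℓ := Nat.cast_nonneg ℓ
    have hW0 : (0 : ℝ) ≤ W := Nat.cast_nonneg W
    have hp1 : (1 : ℝ) ≤ 2 * ((ℓ : ℝ) + W) + 1 := by linarith
    have hp4 : 2 * ((ℓ : ℝ) + W) + 1 ≤ (2 * ((ℓ : ℝ) + W) + 1) ^ 4 := le_self_pow₀ hp1 (by norm_num)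
    rw [hq]
    push_cast
    linarith

end Summit.QuantumFields.QCD.Cruxes.TipPricing.ModularTemplate

end
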